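import Literature.Analysis.FluidPDE.OnsagerBDSVStationaryPhaseAntidiv
import Literature.Analysis.FluidPDE.OnsagerBDSVStationaryPhaseBounds
import Literature.Analysis.FunctionSpaces.HolderEnvelope
import HarnessLib

/-!
# BDSV stationary phase, V: Hölder envelopes of the field `F` and of the iterates `Lⁿ a`

Buckmaster–De Lellis–Székelyhidi–Vicol 2019, App. C, Prop. C.2 for `ℛ` / Daneri–Székelyhidi
2017, Lemma 2.2 (ii). Part III (`OnsagerBDSVStationaryPhaseAntidiv.lean`) reduced the estimate
of `‖ℛ(cos(ψ+θ) a)‖_{C^{0,α}}` to bounds on `‖Lⁿ a‖_∞` and `‖Lⁿ a‖_{C^{0,α}}` for the iterates of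
`L b = div(b F)`, `F = ∇ψ/|∇ψ|²` (Daneri–Székelyhidi's `aₙ`). Their printed bound,
`[a_N ∇φ/|∇φ|²]_s ≤ C([a]_{N+s} + ‖a‖₀[∇φ]_{N+s})`, is proved here in the geometric bookkeeping of
`HolderEnvelope` (`FunctionSpaces/HolderEnvelope.lean`: `‖f‖_{j,0} ≤ A ρʲ`, `‖f‖_{j,r} ≤ H ρʲ`),
into which the interpolation inequality (A.1) puts the amplitude `a` and the phase gradient `∇D`
(part VI):

* `BDSV.holderEnvelope_lift_dirVec` — `dirVec = m̂ + (∇D)ᵀm̂` inherits the envelope of `∇D̃`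
  (amplitudes `+1`);
* `BDSV.holderEnvelope_lift_ibpField` — `F = (2π|m|)⁻¹ u/|u|²`, `u = dirVec`: the square norm
  `|u|² ≥ Ĉ⁻²` by the bilinear rule, its reciprocal by `HolderEnvelope.inv`, the product by the
  bilinear rule; amplitudes `(K c, K c (1 + H_g))`, `c = (2π|m|)⁻¹`, `K = K(Ĉ, n, A_g, C_w)`;
* `BDSV.holderEnvelope_lift_ibpOpVec` — one application of `L` (vector form, componentwise):
  product, one derivative, evaluation, sums; amplitudes `(K A_b A_F γ, K (H_b A_F + A_b H_F) γ)`,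
  one order lost;
* `BDSV.holderEnvelope_lift_iterate_ibpOpVec` — the induction on `n`:
  `Lⁿ a` has the envelope `(A Yⁿγⁿ, Yⁿγⁿ(H_a + n A H_F), γ)` to order `N - n`, `Y = K (A_F + 1)`;
* the order-zero bound on `F` of part III sharpened to the norm of the phase GRADIENT
  (`BDSV.eContDiffHolderNorm_ibpField_le'`: `‖Fₗ‖_{0,r} ≤ c (Ĉ + 3Ĉ⁴ ‖∇D‖_{0,r})`, no `‖D‖₀`), and
  the corresponding reduction `BDSV.antidivergence_phaseCos_smul_le_iterates₂`.

## References

* T. Buckmaster, C. De Lellis, L. Székelyhidi Jr., V. Vicol, *Onsager's conjecture for admissible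
  weak solutions*, CPAM 72 (2019) = arXiv:1701.08678, App. C, Prop. C.2; App. A.
  [`BuckmasterEtAl2018`]
* S. Daneri, L. Székelyhidi Jr., *Non-uniqueness and h-principle for Hölder-continuous weak
  solutions of the Euler equations*, ARMA 224 (2017) = arXiv:1603.09714, Lemma 2.2 (proof,
  the bound (E:a_N2) on the iterates). [`DaneriSzekelyhidi2017`]
-/

noncomputable section

open Set MeasureTheory Complex
open scoped NNReal ENNReal ContDiff InnerProductSpace

-- operator norms `‖B‖ₑ` of bilinear maps into spaces of linear maps need one more level of
-- pending instance problems (as in `ContDiffHolderLeibniz.lean`)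
set_option maxSynthPendingDepth 3

namespace Literature.Analysis.FluidPDE

namespace BDSV

open FunctionSpaces FunctionSpaces.Torus

/-- The flat three-torus `T³ = (ℝ/ℤ)³`, local notation. -/
local notation "𝕋³" => UnitAddTorus (Fin 3)

/-- Euclidean `ℝ³`, local notation. -/
local notation "ℝ³" => EuclideanSpace ℝ (Fin 3)

variable {Ĉ : ℝ} {D : 𝕋³ → ℝ³} {m : Fin 3 → ℤ}

/-! ### The order-zero bound on `F` through the phase gradient, and the sharpened reduction -/

/-- `[dirVec]_r ≤ ‖∇D‖_{C^{0,r}}` — the Hölder seminorm of the direction field is controlled by the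
`C^{0,r}` norm of the GRADIENT `Torus.fderiv D` (not of `D`). [folklore] -/
theorem eHolderNorm_lift_dirVec_le' (r : ℝ≥0) (hm : m ≠ 0) :
    eHolderNorm r (lift (dirVec m D)) ≤ Torus.eContDiffHolderNorm 0 r (Torus.fderiv D) := by
  have h1 : eHolderNorm r (lift (dirVec m D)) =
      eHolderNorm r (fun y => adjApply (unitFreq m) (fderiv ℝ (lift D) y)) := by
    refine eHolderNorm_congr_edist r fun y z => ?_
    rw [lift_dirVec]
    simp only [edist_add_left]
  have h2 : eHolderNorm r (fun y => adjApply (unitFreq m) (fderiv ℝ (lift D) y)) ≤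
      (1 : ℝ≥0) * eHolderNorm r (fderiv ℝ (lift D)) := by
    refine Torus.eHolderNorm_comp_le_mul r ?_ (fderiv ℝ (lift D))
    refine (adjApply (unitFreq m)).lipschitz.weaken ?_
    rw [← NNReal.coe_le_coe, coe_nnnorm, NNReal.coe_one]
    exact (opNorm_adjApply_le _).trans (norm_unitFreq hm).le
  rw [h1]
  refine h2.trans ?_
  rw [ENNReal.coe_one, one_mul, ← lift_fderiv_eq]
  unfold Torus.eContDiffHolderNorm
  rw [eContDiffHolderNorm_zero_eq]
  exact le_add_self

/-- **The field `F` at order zero, through the phase gradient**: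
`‖Fₗ‖_{C^{0,r}} ≤ (2π|m|)⁻¹ (Ĉ + 3Ĉ⁴ ‖∇D‖_{C^{0,r}})` (as `BDSV.eContDiffHolderNorm_ibpField_le`, with
`BDSV.eHolderNorm_lift_dirVec_le'`). [folklore] -/
theorem eContDiffHolderNorm_ibpField_le' (hĈ : 1 ≤ Ĉ) (hND : IsNondegenerateDisplacement Ĉ D)
    (hm : m ≠ 0) (l : Fin 3) (r : ℝ≥0) :
    Torus.eContDiffHolderNorm 0 r (ibpField m D l) ≤
      ENNReal.ofReal ((2 * Real.pi * ‖latticeVec m‖)⁻¹ * Ĉ) +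
        ENNReal.ofReal ((2 * Real.pi * ‖latticeVec m‖)⁻¹ * (3 * Ĉ ^ 4)) *
          Torus.eContDiffHolderNorm 0 r (Torus.fderiv D) := by
  have hC : 0 < Ĉ := lt_of_lt_of_le one_pos hĈ
  have hc : 0 < (2 * Real.pi * ‖latticeVec m‖)⁻¹ := by
    have := norm_latticeVec_pos hm; positivity
  unfold Torus.eContDiffHolderNorm
  rw [eContDiffHolderNorm_zero_eq, eSupNorm_lift]
  refine add_le_add (eSupNorm_ibpField_le hĈ hND hm l) ?_
  have hshell : ∀ y, Ĉ⁻¹ ≤ ‖lift (dirVec m D) y‖ ∧ ‖lift (dirVec m D) y‖ ≤ Ĉ := fun y => by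
    rw [lift_apply]; exact ⟨inv_le_norm_dirVec hĈ hND hm _, norm_dirVec_le hND hm _⟩
  have hincr : ∀ y z, edist (lift (ibpField m D l) y) (lift (ibpField m D l) z) ≤
      ENNReal.ofReal ((2 * Real.pi * ‖latticeVec m‖)⁻¹ * (3 * Ĉ ^ 4)) *
        edist (lift (dirVec m D) y) (lift (dirVec m D) z) := by
    intro y z
    rw [edist_dist, edist_dist, ← ENNReal.ofReal_mul (by positivity), dist_eq_norm, dist_eq_norm]
    refine ENNReal.ofReal_le_ofReal ?_
    rw [lift_ibpField]
    simp only [Function.comp_apply]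
    rw [← mul_sub, norm_mul, Real.norm_eq_abs, abs_of_pos hc]
    have hcomp : ‖recipVec (lift (dirVec m D) y) l - recipVec (lift (dirVec m D) z) l‖ ≤
        ‖recipVec (lift (dirVec m D) y) - recipVec (lift (dirVec m D) z)‖ := by
      rw [← PiLp.sub_apply]
      exact PiLp.norm_apply_le _ l
    calc (2 * Real.pi * ‖latticeVec m‖)⁻¹ *
          ‖recipVec (lift (dirVec m D) y) l - recipVec (lift (dirVec m D) z) l‖
        ≤ (2 * Real.pi * ‖latticeVec m‖)⁻¹ *
            (3 * Ĉ ^ 4 * ‖lift (dirVec m D) y - lift (dirVec m D) z‖) :=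
          mul_le_mul_of_nonneg_left (hcomp.trans (norm_recipVec_sub_le hĈ (hshell y).1
            (hshell y).2 (hshell z).1 (hshell z).2)) hc.le
      _ = _ := by ring
  have hH : eHolderNorm r (lift (ibpField m D l)) ≤
      ENNReal.ofReal ((2 * Real.pi * ‖latticeVec m‖)⁻¹ * (3 * Ĉ ^ 4)) *
        eHolderNorm r (lift (dirVec m D)) := by
    by_cases hmem : MemHolder r (lift (dirVec m D))
    · have hHW := hmem.holderWith
      refine (HolderWith.eHolderNorm_le (C := Real.toNNReal ((2 * Real.pi * ‖latticeVec m‖)⁻¹ *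
        (3 * Ĉ ^ 4)) * nnHolderNorm r (lift (dirVec m D))) fun y z => ?_).trans (le_of_eq ?_)
      · calc edist (lift (ibpField m D l) y) (lift (ibpField m D l) z)
            ≤ ENNReal.ofReal ((2 * Real.pi * ‖latticeVec m‖)⁻¹ * (3 * Ĉ ^ 4)) *
                edist (lift (dirVec m D) y) (lift (dirVec m D) z) := hincr y z
          _ ≤ ENNReal.ofReal ((2 * Real.pi * ‖latticeVec m‖)⁻¹ * (3 * Ĉ ^ 4)) *
                ((nnHolderNorm r (lift (dirVec m D)) : ℝ≥0∞) * edist y z ^ (r : ℝ)) :=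
              mul_le_mul_of_nonneg_left (hHW y z) bot_le
          _ = _ := by rw [ENNReal.coe_mul, ENNReal.ofReal]; ring
      · rw [ENNReal.coe_mul, hmem.coe_nnHolderNorm_eq_eHolderNorm, ENNReal.ofReal]
    · have htop : eHolderNorm r (lift (dirVec m D)) = ⊤ := by
        rwa [← eHolderNorm_ne_top, not_ne_iff] at hmem
      rw [htop, ENNReal.mul_top (by positivity)]
      exact le_top
  rw [← Torus.eContDiffHolderNorm]
  exact hH.trans (mul_le_mul_of_nonneg_left (eHolderNorm_lift_dirVec_le' r hm) bot_le)

/-- **The product `Fₗ cos(ψ+θ')` at order zero, through the phase gradient** (`r ≤ 1`):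
`‖Fₗ cos‖_{C^{0,r}} ≤ (Ĉ/(2π|m|)) (2πĈ+3)|m|^r + (2π|m|)⁻¹(Ĉ + 3Ĉ⁴‖∇D‖_{C^{0,r}})`. [folklore] -/
theorem eContDiffHolderNorm_ibpField_mul_phaseCos_le' (hĈ : 1 ≤ Ĉ) (hD : IsSmooth D)
    (hND : IsNondegenerateDisplacement Ĉ D) (hm : m ≠ 0) (l : Fin 3) (θ' : ℝ) {r : ℝ≥0}
    (hr : r ≤ 1) :
    Torus.eContDiffHolderNorm 0 r (fun x => ibpField m D l x * phaseCos m D θ' x) ≤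
      ENNReal.ofReal ((2 * Real.pi * ‖latticeVec m‖)⁻¹ * Ĉ) *
          (ENNReal.ofReal (2 * Real.pi * Ĉ + 3) * freqPow m r) +
        (ENNReal.ofReal ((2 * Real.pi * ‖latticeVec m‖)⁻¹ * Ĉ) +
          ENNReal.ofReal ((2 * Real.pi * ‖latticeVec m‖)⁻¹ * (3 * Ĉ ^ 4)) *
            Torus.eContDiffHolderNorm 0 r (Torus.fderiv D)) := by
  have h := eContDiffHolderNorm_zero_smul_le_sharp r (ibpField m D l) (phaseCos m D θ')
  simp only [smul_eq_mul] at h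
  refine h.trans (add_le_add ?_ ?_)
  · exact mul_le_mul' (eSupNorm_ibpField_le hĈ hND hm l)
      (eContDiffHolderNorm_phaseCos_le hĈ hD hND hm θ' hr)
  · calc Torus.eContDiffHolderNorm 0 r (ibpField m D l) * eSupNorm (phaseCos m D θ')
        ≤ Torus.eContDiffHolderNorm 0 r (ibpField m D l) * 1 :=
          mul_le_mul_of_nonneg_left (eSupNorm_phaseCos_le m D θ') bot_le
      _ ≤ _ := by rw [mul_one]; exact eContDiffHolderNorm_ibpField_le' hĈ hND hm l r

/-- **The `ℛ` estimate reduced to bounds on the iterates, through the phase gradient**: the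
reduction `BDSV.antidivergence_phaseCos_smul_le_iterates` with `‖D‖_{C^{1,α}}` replaced by
`‖∇D‖_{C^{0,α}} = ‖Torus.fderiv D‖_{0,α}` (so that every quantity has the homogeneity of the
target estimate). [cite: BuckmasterEtAl2018, App. C Prop. C.2] -/
theorem antidivergence_phaseCos_smul_le_iterates₂ (hĈ : 1 ≤ Ĉ) (hD : IsSmooth D)
    (hND : IsNondegenerateDisplacement Ĉ D) (hm : m ≠ 0) (θ : ℝ) {a : 𝕋³ → ℝ³} (ha : IsSmooth a)
    {α : ℝ≥0} (hα : α ≤ 1) {Cd Cr : ℝ≥0}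
    (hCd : ∀ A : 𝕋³ → Fin 3 → ℝ³, IsSmooth A →
      Torus.eContDiffHolderNorm 0 α (Torus.antidivergence (Torus.tensorDivergence A)) ≤
        Cd * Torus.eContDiffHolderNorm 0 α A)
    (hCr : ∀ v : 𝕋³ → ℝ³, IsSmooth v →
      Torus.eContDiffHolderNorm 0 α (Torus.antidivergence v) ≤ Cr * Torus.eContDiffHolderNorm 0 α v)
    (N : ℕ) :
    Torus.eContDiffHolderNorm 0 α (Torus.antidivergence fun x => phaseCos m D θ x • a x) ≤
      Cd * ∑ n ∈ Finset.range N, ∑ _l : Fin 3,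
          (ENNReal.ofReal ((2 * Real.pi * ‖latticeVec m‖)⁻¹ * Ĉ) *
              Torus.eContDiffHolderNorm 0 α ((ibpOpVec m D)^[n] a) +
            (ENNReal.ofReal ((2 * Real.pi * ‖latticeVec m‖)⁻¹ * Ĉ) *
                (ENNReal.ofReal (2 * Real.pi * Ĉ + 3) * freqPow m α) +
              (ENNReal.ofReal ((2 * Real.pi * ‖latticeVec m‖)⁻¹ * Ĉ) +
                ENNReal.ofReal ((2 * Real.pi * ‖latticeVec m‖)⁻¹ * (3 * Ĉ ^ 4)) *
                  Torus.eContDiffHolderNorm 0 α (Torus.fderiv D))) *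
              eSupNorm ((ibpOpVec m D)^[n] a)) +
        Cr * (Torus.eContDiffHolderNorm 0 α ((ibpOpVec m D)^[N] a) +
          ENNReal.ofReal (2 * Real.pi * Ĉ + 3) * freqPow m α * eSupNorm ((ibpOpVec m D)^[N] a)) := by
  refine (antidivergence_phaseCos_smul_le hĈ hD hND hm θ ha hCd hCr N).trans (add_le_add ?_ ?_)
  · refine mul_le_mul_of_nonneg_left (Finset.sum_le_sum fun n _ => ?_) bot_le
    have hb := isSmooth_iterate_ibpOpVec hĈ hD hND hm ha n
    refine (eContDiffHolderNorm_modeTensor_le hĈ hD hND hm _ hb α).trans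
      (Finset.sum_le_sum fun l _ => add_le_add ?_ ?_)
    · exact mul_le_mul_of_nonneg_right (eSupNorm_ibpField_mul_phaseCos_le hĈ hND hm l _) bot_le
    · exact mul_le_mul_of_nonneg_right
        (eContDiffHolderNorm_ibpField_mul_phaseCos_le' hĈ hD hND hm l _ hα) bot_le
  · refine mul_le_mul_of_nonneg_left ?_ bot_le
    have hb := isSmooth_iterate_ibpOpVec hĈ hD hND hm ha N
    refine (eContDiffHolderNorm_zero_smul_le_sharp α (phaseCos m D _) ((ibpOpVec m D)^[N] a)).trans
      (add_le_add ?_ ?_)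
    · calc eSupNorm (phaseCos m D (θ + N * (Real.pi / 2))) *
            Torus.eContDiffHolderNorm 0 α ((ibpOpVec m D)^[N] a)
          ≤ 1 * Torus.eContDiffHolderNorm 0 α ((ibpOpVec m D)^[N] a) :=
            mul_le_mul_of_nonneg_right (eSupNorm_phaseCos_le m D _) bot_le
        _ = _ := one_mul _
    · exact mul_le_mul_of_nonneg_right (eContDiffHolderNorm_phaseCos_le hĈ hD hND hm _ hα) bot_le

/-! ### Envelopes of the direction field and of `F` -/

section Field

variable {n : ℕ} {r : ℝ≥0} {Ag : ℝ≥0} {Hg ρ : ℝ≥0∞}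

/-- `‖adjApply m̂‖ ≤ 1` in `ℝ≥0∞`. [folklore] -/
theorem enorm_adjApply_unitFreq_le (hm : m ≠ 0) : ‖adjApply (unitFreq m)‖ₑ ≤ 1 := by
  rw [enorm_eq_nnnorm, ← ENNReal.coe_one, ENNReal.coe_le_coe, ← NNReal.coe_le_coe, coe_nnnorm,
    NNReal.coe_one]
  exact (opNorm_adjApply_le _).trans (norm_unitFreq hm).le

/-- **The direction field inherits the envelope of the phase gradient**: if `∇D̃` has the
envelope `(A_g, H_g, ρ)` to order `n` then `dirVec = m̂ + (∇D̃)ᵀm̂` has `(1 + A_g, 1 + H_g, ρ)`.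
[folklore] -/
theorem holderEnvelope_lift_dirVec (hm : m ≠ 0)
    (hg : HolderEnvelope (fderiv ℝ (lift D)) n r Ag Hg ρ) :
    HolderEnvelope (lift (dirVec m D)) n r (1 + Ag) (1 + Hg) ρ := by
  rw [lift_dirVec]
  have h1 := HolderEnvelope.const (E := ℝ³) (unitFreq m) n r hg.one_le
  have h2 := hg.clm_comp (adjApply (unitFreq m))
  have h := h1.add h2
  refine h.mono le_rfl ?_ ?_
  · rw [show ‖unitFreq m‖ₑ = 1 by rw [enorm_eq_nnnorm, ← ENNReal.coe_one, ENNReal.coe_inj,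
      ← NNReal.coe_inj, coe_nnnorm, NNReal.coe_one, norm_unitFreq hm]]
    gcongr
    calc ‖adjApply (unitFreq m)‖ₑ * (Ag : ℝ≥0∞) ≤ 1 * Ag :=
          mul_le_mul_of_nonneg_right (enorm_adjApply_unitFreq_le hm) bot_le
      _ = Ag := one_mul _
  · rw [show ‖unitFreq m‖ₑ = 1 by rw [enorm_eq_nnnorm, ← ENNReal.coe_one, ENNReal.coe_inj,
      ← NNReal.coe_inj, coe_nnnorm, NNReal.coe_one, norm_unitFreq hm]]
    gcongr
    calc ‖adjApply (unitFreq m)‖ₑ * Hg ≤ 1 * Hg :=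
          mul_le_mul_of_nonneg_right (enorm_adjApply_unitFreq_le hm) bot_le
      _ = Hg := one_mul _

/-- `‖innerSL‖ ≤ 1` in `ℝ≥0∞`. [folklore] -/
theorem enorm_innerSL_le_one : ‖(innerSL ℝ : ℝ³ →L[ℝ] ℝ³ →L[ℝ] ℝ)‖ₑ ≤ 1 := by
  rw [enorm_eq_nnnorm, ← ENNReal.coe_one, ENNReal.coe_le_coe, ← NNReal.coe_le_coe, coe_nnnorm,
    NNReal.coe_one]
  refine ContinuousLinearMap.opNorm_le_bound _ zero_le_one fun v => ?_
  rw [one_mul, innerSL_apply_norm]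

/-- The sup-amplitude bound of `|u|²` used for the reciprocal rule:
`K_s(n, A_g) = 2·3ⁿ(n+1)(1 + A_g)²`. [folklore] -/
def normSqConst (n : ℕ) (Ag : ℝ≥0) : ℝ≥0 := 2 * (3 ^ n * ((n : ℝ≥0) + 1)) * (1 + Ag) ^ 2

/-- **The square norm of the direction field**: `s = |dirVec|²` has the envelope
`(K_s, 3ⁿ(n+1)·2(1+H_g)(1+A_g), ρ)` and the lower bound `s ≥ Ĉ⁻²`. [folklore] -/
theorem holderEnvelope_normSq_dirVec (hm : m ≠ 0)
    (hg : HolderEnvelope (fderiv ℝ (lift D)) n r Ag Hg ρ) :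
    HolderEnvelope (fun y => ⟪lift (dirVec m D) y, lift (dirVec m D) y⟫_ℝ) n r
      (normSqConst n Ag) (3 ^ n * (n + 1) * (2 * ((1 + Hg) * (1 + (Ag : ℝ≥0∞))))) ρ := by
  have hu := holderEnvelope_lift_dirVec hm hg
  have h := hu.bilinear (innerSL ℝ : ℝ³ →L[ℝ] ℝ³ →L[ℝ] ℝ) hu
  refine h.mono le_rfl ?_ ?_
  · rw [normSqConst]
    push_cast
    calc 2 * (3 ^ n * ((n : ℝ≥0∞) + 1)) * ‖(innerSL ℝ : ℝ³ →L[ℝ] ℝ³ →L[ℝ] ℝ)‖ₑ *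
          ((1 + (Ag : ℝ≥0∞)) * (1 + Ag))
        ≤ 2 * (3 ^ n * ((n : ℝ≥0∞) + 1)) * 1 * ((1 + (Ag : ℝ≥0∞)) * (1 + Ag)) := by
          gcongr; exact enorm_innerSL_le_one
      _ = _ := by ring
  · calc 3 ^ n * ((n : ℝ≥0∞) + 1) * ‖(innerSL ℝ : ℝ³ →L[ℝ] ℝ³ →L[ℝ] ℝ)‖ₑ *
          ((1 + Hg) * (1 + (Ag : ℝ≥0∞)) + (1 + Ag) * (1 + Hg))
        ≤ 3 ^ n * ((n : ℝ≥0∞) + 1) * 1 * ((1 + Hg) * (1 + (Ag : ℝ≥0∞)) + (1 + Ag) * (1 + Hg)) := by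
          gcongr; exact enorm_innerSL_le_one
      _ = _ := by ring

/-- `|dirVec|² ≥ Ĉ⁻²` under non-degeneracy. [folklore] -/
theorem inv_sq_le_normSq_dirVec (hĈ : 1 ≤ Ĉ) (hND : IsNondegenerateDisplacement Ĉ D) (hm : m ≠ 0)
    (y : ℝ³) : (Ĉ ^ 2)⁻¹ ≤ ⟪lift (dirVec m D) y, lift (dirVec m D) y⟫_ℝ := by
  rw [real_inner_self_eq_norm_sq, lift_apply, ← inv_pow]
  have hC : 0 < Ĉ := lt_of_lt_of_le one_pos hĈ
  exact pow_le_pow_left₀ (inv_nonneg.2 hC.le) (inv_le_norm_dirVec hĈ hND hm _) 2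

/-- The lift of `Fₗ` as `c · s⁻¹ · uₗ` with `u = dirVec`, `s = |u|²`, `c = (2π|m|)⁻¹`. [folklore] -/
theorem lift_ibpField_eq_mul (m : Fin 3 → ℤ) (D : 𝕋³ → ℝ³) (l : Fin 3) :
    lift (ibpField m D l) = fun y => (2 * Real.pi * ‖latticeVec m‖)⁻¹ *
      ((⟪lift (dirVec m D) y, lift (dirVec m D) y⟫_ℝ)⁻¹ * lift (dirVec m D) y l) := by
  funext y
  rw [lift_ibpField]
  simp only [Function.comp_apply, recipVec, PiLp.smul_apply, smul_eq_mul,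
    real_inner_self_eq_norm_sq]

/-- The constant of the envelope of `F`: `K_F(n, A_g, C_w) = 3·(3ⁿ(n+1))²·C_w·(1+A_g)²`.
[folklore] -/
def ibpFieldConst (n : ℕ) (Ag Cw : ℝ≥0) : ℝ≥0 := 3 * (3 ^ n * ((n : ℝ≥0) + 1)) ^ 2 * Cw * (1 + Ag) ^ 2

/-- **The envelope of the field `F`**: if `∇D̃` has the envelope `(A_g, H_g, ρ)` to order `n`, and
`C_w` is a constant of the reciprocal rule at order `n` for the lower bound `Ĉ⁻²` and the sup
amplitude `K_s(n, A_g)` (`HolderEnvelope.inv`), then every `Fₗ` has the envelope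
`(K_F c, K_F c (1 + H_g), ρ)` to order `n`, `c = (2π|m|)⁻¹`. [folklore] -/
theorem holderEnvelope_lift_ibpField (hĈ : 1 ≤ Ĉ) (hND : IsNondegenerateDisplacement Ĉ D)
    (hm : m ≠ 0) (hg : HolderEnvelope (fderiv ℝ (lift D)) n r Ag Hg ρ) {Cw : ℝ≥0}
    (hCw : ∀ {s : ℝ³ → ℝ} {H' ρ' : ℝ≥0∞}, HolderEnvelope s n r (normSqConst n Ag) H' ρ' →
      (∀ y, (Ĉ ^ 2)⁻¹ ≤ s y) → HolderEnvelope (fun y => (s y)⁻¹) n r Cw (Cw * H') ρ')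
    (l : Fin 3) :
    HolderEnvelope (lift (ibpField m D l)) n r
      (ENNReal.ofReal (2 * Real.pi * ‖latticeVec m‖)⁻¹ * ibpFieldConst n Ag Cw)
      (ENNReal.ofReal (2 * Real.pi * ‖latticeVec m‖)⁻¹ * ibpFieldConst n Ag Cw * (1 + Hg)) ρ := by
  have hc0 : 0 < (2 * Real.pi * ‖latticeVec m‖)⁻¹ := by
    have := norm_latticeVec_pos hm; positivity
  set c₀ : ℝ≥0∞ := 3 ^ n * (n + 1) with hc₀
  have hc₀1 : 1 ≤ c₀ := by
    rw [hc₀]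
    calc (1 : ℝ≥0∞) = 1 * 1 := (one_mul 1).symm
      _ ≤ 3 ^ n * (n + 1) := mul_le_mul' (one_le_pow₀ (by norm_num)) (by
          exact le_add_self)
  have hu := holderEnvelope_lift_dirVec hm hg
  have hs := holderEnvelope_normSq_dirVec hm hg
  have hw := hCw hs (inv_sq_le_normSq_dirVec hĈ hND hm)
  -- the component `uₗ`
  have hul : HolderEnvelope (fun y => lift (dirVec m D) y l) n r (1 + Ag) (1 + Hg) ρ := by
    have h := hu.clm_comp (EuclideanSpace.proj l : ℝ³ →L[ℝ] ℝ)
    have hP : ‖(EuclideanSpace.proj l : ℝ³ →L[ℝ] ℝ)‖ₑ ≤ 1 := by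
      rw [enorm_eq_nnnorm, ← ENNReal.coe_one, ENNReal.coe_le_coe, ← NNReal.coe_le_coe, coe_nnnorm,
        NNReal.coe_one]
      exact opNorm_euclidean_proj_le l
    refine h.mono le_rfl ?_ ?_
    · calc ‖(EuclideanSpace.proj l : ℝ³ →L[ℝ] ℝ)‖ₑ * (1 + (Ag : ℝ≥0∞)) ≤ 1 * (1 + Ag) :=
          mul_le_mul_of_nonneg_right hP bot_le
        _ = _ := one_mul _
    · calc ‖(EuclideanSpace.proj l : ℝ³ →L[ℝ] ℝ)‖ₑ * (1 + Hg) ≤ 1 * (1 + Hg) :=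
          mul_le_mul_of_nonneg_right hP bot_le
        _ = _ := one_mul _
  -- the product `s⁻¹ uₗ`
  have hprod := hw.bilinear (ContinuousLinearMap.mul ℝ ℝ) hul
  simp only [ContinuousLinearMap.mul_apply'] at hprod
  -- the constant `c`
  have hF := hprod.const_mul (2 * Real.pi * ‖latticeVec m‖)⁻¹
  rw [lift_ibpField_eq_mul]
  have hcn : ‖(2 * Real.pi * ‖latticeVec m‖)⁻¹‖ₑ = ENNReal.ofReal (2 * Real.pi * ‖latticeVec m‖)⁻¹ := by
    rw [Real.enorm_eq_ofReal hc0.le]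
  rw [hcn] at hF
  refine hF.mono le_rfl ?_ ?_
  · refine mul_le_mul' le_rfl ?_
    rw [ibpFieldConst]
    push_cast
    rw [← hc₀]
    calc 2 * c₀ * ‖(ContinuousLinearMap.mul ℝ ℝ : ℝ →L[ℝ] ℝ →L[ℝ] ℝ)‖ₑ *
          ((Cw : ℝ≥0∞) * (1 + (Ag : ℝ≥0∞)))
        ≤ 2 * c₀ * 1 * ((Cw : ℝ≥0∞) * (1 + (Ag : ℝ≥0∞))) := by
          gcongr; exact FunctionSpaces.enorm_mul_le_one
      _ = 2 * c₀ * Cw * (1 + Ag) := by ring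
      _ ≤ 3 * c₀ ^ 2 * Cw * (1 + Ag) ^ 2 := by
          have h1 : (2 : ℝ≥0∞) ≤ 3 := by norm_num
          have h2 : c₀ ≤ c₀ ^ 2 := by
            calc c₀ = c₀ * 1 := (mul_one _).symm
              _ ≤ c₀ * c₀ := mul_le_mul' le_rfl hc₀1
              _ = c₀ ^ 2 := (sq _).symm
          have h3 : (1 + (Ag : ℝ≥0∞)) ≤ (1 + Ag) ^ 2 := by
            calc (1 + (Ag : ℝ≥0∞)) = (1 + Ag) * 1 := (mul_one _).symm
              _ ≤ (1 + Ag) * (1 + Ag) := mul_le_mul' le_rfl le_self_add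
              _ = (1 + Ag) ^ 2 := (sq _).symm
          gcongr
  · refine le_trans ?_ (le_of_eq (mul_assoc _ _ _).symm)
    refine mul_le_mul' le_rfl ?_
    rw [ibpFieldConst]
    push_cast
    rw [← hc₀]
    calc c₀ * ‖(ContinuousLinearMap.mul ℝ ℝ : ℝ →L[ℝ] ℝ →L[ℝ] ℝ)‖ₑ *
          ((Cw : ℝ≥0∞) * (c₀ * (2 * ((1 + Hg) * (1 + (Ag : ℝ≥0∞))))) * (1 + (Ag : ℝ≥0∞)) +
            Cw * (1 + Hg))
        ≤ c₀ * 1 * ((Cw : ℝ≥0∞) * (c₀ * (2 * ((1 + Hg) * (1 + (Ag : ℝ≥0∞))))) * (1 + (Ag : ℝ≥0∞)) +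
            Cw * (1 + Hg)) := by
          gcongr; exact FunctionSpaces.enorm_mul_le_one
      _ = (2 * c₀ ^ 2 * Cw * (1 + Ag) ^ 2 + c₀ * Cw) * (1 + Hg) := by ring
      _ ≤ (2 * c₀ ^ 2 * Cw * (1 + Ag) ^ 2 + c₀ ^ 2 * Cw * (1 + Ag) ^ 2) * (1 + Hg) := by
          refine mul_le_mul' (add_le_add le_rfl ?_) le_rfl
          calc c₀ * (Cw : ℝ≥0∞) = c₀ * 1 * Cw * 1 := by ring
            _ ≤ c₀ * c₀ * Cw * (1 + (Ag : ℝ≥0∞)) ^ 2 :=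
                mul_le_mul' (mul_le_mul' (mul_le_mul' le_rfl hc₀1) le_rfl)
                  (one_le_pow₀ le_self_add)
            _ = c₀ ^ 2 * Cw * (1 + Ag) ^ 2 := by ring
      _ = 3 * c₀ ^ 2 * Cw * (1 + Ag) ^ 2 * (1 + Hg) := by ring

end Field

/-! ### One application of `L`, and the iterates -/

section Iterates

variable {k : ℕ} {r : ℝ≥0} {γ : ℝ≥0∞}

/-- `‖proj‖ ≤ 1` in `ℝ≥0∞` (the coordinate projections of `ℝ³`). [folklore] -/
theorem enorm_proj_le_one (l : Fin 3) : ‖(EuclideanSpace.proj l : ℝ³ →L[ℝ] ℝ)‖ₑ ≤ 1 := by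
  rw [enorm_eq_nnnorm, ← ENNReal.coe_one, ENNReal.coe_le_coe, ← NNReal.coe_le_coe, coe_nnnorm,
    NNReal.coe_one]
  exact opNorm_euclidean_proj_le l

/-- `‖apply eⱼ‖ ≤ 1` in `ℝ≥0∞` (evaluation of a linear form at a unit coordinate vector). [folklore] -/
theorem enorm_apply_single_le_one (j : Fin 3) :
    ‖(ContinuousLinearMap.apply ℝ ℝ (EuclideanSpace.single j (1 : ℝ)) : (ℝ³ →L[ℝ] ℝ) →L[ℝ] ℝ)‖ₑ ≤ 1 := by
  rw [enorm_eq_nnnorm, ← ENNReal.coe_one, ENNReal.coe_le_coe, ← NNReal.coe_le_coe, coe_nnnorm,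
    NNReal.coe_one]
  refine ContinuousLinearMap.opNorm_le_bound _ zero_le_one fun f => ?_
  rw [ContinuousLinearMap.apply_apply, one_mul]
  calc ‖f (EuclideanSpace.single j (1 : ℝ))‖ ≤ ‖f‖ * ‖EuclideanSpace.single j (1 : ℝ)‖ := f.le_opNorm _
    _ = ‖f‖ := by simp

/-- `‖smulRight 1 eᵢ‖ ≤ 1` in `ℝ≥0∞` (the map `t ↦ t eᵢ`). [folklore] -/
theorem enorm_smulRight_single_le_one (i : Fin 3) :
    ‖((ContinuousLinearMap.id ℝ ℝ).smulRight (EuclideanSpace.single i (1 : ℝ)) : ℝ →L[ℝ] ℝ³)‖ₑ ≤ 1 := by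
  rw [enorm_eq_nnnorm, ← ENNReal.coe_one, ENNReal.coe_le_coe, ← NNReal.coe_le_coe, coe_nnnorm,
    NNReal.coe_one]
  refine ContinuousLinearMap.opNorm_le_bound _ zero_le_one fun t => ?_
  rw [ContinuousLinearMap.smulRight_apply, ContinuousLinearMap.id_apply, norm_smul, one_mul]
  simp

/-- The lift of the vector operator `L` as a sum over components and coordinates:
`(L a)∼ = Σᵢ (Σⱼ D(ãᵢ F̃ⱼ)(·)(eⱼ)) • eᵢ`. [folklore] -/
theorem lift_ibpOpVec (hĈ : 1 ≤ Ĉ) (hD : IsSmooth D) (hND : IsNondegenerateDisplacement Ĉ D)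
    (hm : m ≠ 0) {a : 𝕋³ → ℝ³} (ha : IsSmooth a) :
    lift (ibpOpVec m D a) = fun y => ∑ i, (∑ j,
      fderiv ℝ (fun z => lift (fun x => a x i) z * lift (ibpField m D j) z) y
        (EuclideanSpace.single j (1 : ℝ))) • EuclideanSpace.single i (1 : ℝ) := by
  funext y
  have hcomp : ∀ i, lift (ibpOp m D fun x => a x i) y = ∑ j,
      fderiv ℝ (fun z => lift (fun x => a x i) z * lift (ibpField m D j) z) y
        (EuclideanSpace.single j (1 : ℝ)) := fun i => by
    rw [lift_ibpOp hĈ hD hND hm (ha.apply i)]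
  simp only [← hcomp]
  rw [lift_apply, ibpOpVec]
  exact (EuclideanSpace.sum_apply_smul_single_real _).symm

/-- The constant of one application of `L`: `K_L(k) = 18·3^{k+1}(k+2)`. [folklore] -/
def ibpOpConst (k : ℕ) : ℝ≥0∞ := 18 * (3 ^ (k + 1) * ((k : ℝ≥0∞) + 1 + 1))

/-- **One application of `L` in envelope form** (Daneri–Székelyhidi's inductive bound on
`aₙ = -div(aₙ₋₁∇φ/|∇φ|²)`): if `ã` has the envelope `(A_b, H_b, γ)` to order `k+1` and every `F̃ₗ`
has `(A_F, H_F, γ)` to order `k+1`, then `(L a)∼` has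
`(K_L A_b A_F γ, K_L (H_b A_F + A_b H_F) γ, γ)` to order `k`. [cite: DaneriSzekelyhidi2017, Lemma 2.2 (proof)] -/
theorem holderEnvelope_lift_ibpOpVec (hĈ : 1 ≤ Ĉ) (hD : IsSmooth D)
    (hND : IsNondegenerateDisplacement Ĉ D) (hm : m ≠ 0) {a : 𝕋³ → ℝ³} (ha : IsSmooth a)
    {Ab Hb AF HF : ℝ≥0∞} (hb : HolderEnvelope (lift a) (k + 1) r Ab Hb γ)
    (hF : ∀ l, HolderEnvelope (lift (ibpField m D l)) (k + 1) r AF HF γ) :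
    HolderEnvelope (lift (ibpOpVec m D a)) k r (ibpOpConst k * Ab * AF * γ)
      (ibpOpConst k * (Hb * AF + Ab * HF) * γ) γ := by
  have hγ := hb.one_le
  set c₁ : ℝ≥0∞ := 3 ^ (k + 1) * ((k : ℝ≥0∞) + 1 + 1) with hc₁
  -- components of `a`
  have hai : ∀ i, HolderEnvelope (lift fun x => a x i) (k + 1) r Ab Hb γ := fun i => by
    have h := hb.clm_comp (EuclideanSpace.proj i : ℝ³ →L[ℝ] ℝ)
    refine h.mono le_rfl ?_ ?_
    · calc ‖(EuclideanSpace.proj i : ℝ³ →L[ℝ] ℝ)‖ₑ * Ab ≤ 1 * Ab :=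
          mul_le_mul_of_nonneg_right (enorm_proj_le_one i) bot_le
        _ = Ab := one_mul _
    · calc ‖(EuclideanSpace.proj i : ℝ³ →L[ℝ] ℝ)‖ₑ * Hb ≤ 1 * Hb :=
          mul_le_mul_of_nonneg_right (enorm_proj_le_one i) bot_le
        _ = Hb := one_mul _
  -- the products `ãᵢ F̃ⱼ`, their derivatives, evaluated at `eⱼ`
  have hterm : ∀ i j, HolderEnvelope
      (fun y => fderiv ℝ (fun z => lift (fun x => a x i) z * lift (ibpField m D j) z) y
        (EuclideanSpace.single j (1 : ℝ))) k r
      (2 * c₁ * (Ab * AF) * γ) (c₁ * (Hb * AF + Ab * HF) * γ) γ := by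
    intro i j
    have hp := (hai i).bilinear (ContinuousLinearMap.mul ℝ ℝ) (hF j)
    simp only [ContinuousLinearMap.mul_apply'] at hp
    have hp' : HolderEnvelope (fun z => lift (fun x => a x i) z * lift (ibpField m D j) z) (k + 1) r
        (2 * c₁ * (Ab * AF)) (c₁ * (Hb * AF + Ab * HF)) γ := by
      refine hp.mono le_rfl ?_ ?_
      · push_cast
        rw [hc₁]
        calc 2 * (3 ^ (k + 1) * ((k : ℝ≥0∞) + 1 + 1)) * ‖(ContinuousLinearMap.mul ℝ ℝ : ℝ →L[ℝ] ℝ →L[ℝ] ℝ)‖ₑ *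
              (Ab * AF) ≤ 2 * (3 ^ (k + 1) * ((k : ℝ≥0∞) + 1 + 1)) * 1 * (Ab * AF) := by
              gcongr; exact FunctionSpaces.enorm_mul_le_one
          _ = _ := by rw [mul_one]
      · push_cast
        rw [hc₁]
        calc 3 ^ (k + 1) * ((k : ℝ≥0∞) + 1 + 1) * ‖(ContinuousLinearMap.mul ℝ ℝ : ℝ →L[ℝ] ℝ →L[ℝ] ℝ)‖ₑ *
              (Hb * AF + Ab * HF) ≤ 3 ^ (k + 1) * ((k : ℝ≥0∞) + 1 + 1) * 1 * (Hb * AF + Ab * HF) := by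
              gcongr; exact FunctionSpaces.enorm_mul_le_one
          _ = _ := by rw [mul_one]
    have hd := hp'.fderiv
    have he := hd.clm_comp (ContinuousLinearMap.apply ℝ ℝ (EuclideanSpace.single j (1 : ℝ)))
    simp only [ContinuousLinearMap.apply_apply] at he
    refine he.mono le_rfl ?_ ?_
    · calc _ ≤ 1 * (2 * c₁ * (Ab * AF) * γ) :=
          mul_le_mul_of_nonneg_right (enorm_apply_single_le_one j) bot_le
        _ = _ := one_mul _
    · calc _ ≤ 1 * (c₁ * (Hb * AF + Ab * HF) * γ) :=
          mul_le_mul_of_nonneg_right (enorm_apply_single_le_one j) bot_le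
        _ = _ := one_mul _
  -- sum over `j`, then `• eᵢ`, then sum over `i`
  have hrow : ∀ i, HolderEnvelope (fun y => ∑ j,
      fderiv ℝ (fun z => lift (fun x => a x i) z * lift (ibpField m D j) z) y
        (EuclideanSpace.single j (1 : ℝ))) k r
      (3 * (2 * c₁ * (Ab * AF) * γ)) (3 * (c₁ * (Hb * AF + Ab * HF) * γ)) γ := by
    intro i
    have h := HolderEnvelope.sum (Finset.univ : Finset (Fin 3)) hγ fun j _ => hterm i j
    refine h.mono le_rfl (le_of_eq ?_) (le_of_eq ?_) <;>
      simp [Finset.sum_const, Finset.card_univ, Fintype.card_fin]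
  have hvec : ∀ i, HolderEnvelope (fun y => (∑ j,
      fderiv ℝ (fun z => lift (fun x => a x i) z * lift (ibpField m D j) z) y
        (EuclideanSpace.single j (1 : ℝ))) • EuclideanSpace.single i (1 : ℝ)) k r
      (3 * (2 * c₁ * (Ab * AF) * γ)) (3 * (c₁ * (Hb * AF + Ab * HF) * γ)) γ := by
    intro i
    have h := (hrow i).clm_comp
      ((ContinuousLinearMap.id ℝ ℝ).smulRight (EuclideanSpace.single i (1 : ℝ)) : ℝ →L[ℝ] ℝ³)
    simp only [ContinuousLinearMap.smulRight_apply, ContinuousLinearMap.id_apply] at h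
    refine h.mono le_rfl ?_ ?_
    · calc _ ≤ 1 * (3 * (2 * c₁ * (Ab * AF) * γ)) :=
          mul_le_mul_of_nonneg_right (enorm_smulRight_single_le_one i) bot_le
        _ = _ := one_mul _
    · calc _ ≤ 1 * (3 * (c₁ * (Hb * AF + Ab * HF) * γ)) :=
          mul_le_mul_of_nonneg_right (enorm_smulRight_single_le_one i) bot_le
        _ = _ := one_mul _
  have hall := HolderEnvelope.sum (Finset.univ : Finset (Fin 3)) hγ fun i _ => hvec i
  rw [lift_ibpOpVec hĈ hD hND hm ha]
  refine hall.mono le_rfl (le_of_eq ?_) ?_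
  · simp only [Finset.sum_const, Finset.card_univ, Fintype.card_fin, nsmul_eq_mul, ibpOpConst, hc₁]
    push_cast; ring
  · simp only [Finset.sum_const, Finset.card_univ, Fintype.card_fin, nsmul_eq_mul, ibpOpConst, hc₁]
    push_cast
    calc (3 : ℝ≥0∞) * (3 * (3 ^ (k + 1) * ((k : ℝ≥0∞) + 1 + 1) * (Hb * AF + Ab * HF) * γ))
        = 9 * (3 ^ (k + 1) * ((k : ℝ≥0∞) + 1 + 1)) * (Hb * AF + Ab * HF) * γ := by ring
      _ ≤ 18 * (3 ^ (k + 1) * ((k : ℝ≥0∞) + 1 + 1)) * (Hb * AF + Ab * HF) * γ := by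
          gcongr; norm_num

/-- `K_L` is monotone in the order. [folklore] -/
theorem ibpOpConst_mono {k k' : ℕ} (h : k ≤ k') : ibpOpConst k ≤ ibpOpConst k' := by
  unfold ibpOpConst
  gcongr
  · exact le_of_lt (by norm_num)

/-- **The iterates in envelope form** (the induction on `n` of Daneri–Székelyhidi's proof): if
`ã` has the envelope `(A, H_a, γ)` to order `N` and every `F̃ₗ` has `(A_F, A_F Θ, γ)` to order `N`
(Hölder amplitude proportional to the sup amplitude, as delivered by
`BDSV.holderEnvelope_lift_ibpField`), then for `n ≤ N` the iterate `(Lⁿ a)∼` has the envelope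
`(A tⁿ, tⁿ (H_a + n A Θ), γ)` to order `N - n`, with `t = K_L(N) A_F γ` — each application of `L`
costs exactly one factor `A_F ∼ |m|⁻¹` and one factor `γ`. [cite: DaneriSzekelyhidi2017, Lemma 2.2 (proof)] -/
theorem holderEnvelope_lift_iterate_ibpOpVec (hĈ : 1 ≤ Ĉ) (hD : IsSmooth D)
    (hND : IsNondegenerateDisplacement Ĉ D) (hm : m ≠ 0) {a : 𝕋³ → ℝ³} (ha : IsSmooth a) {N : ℕ}
    {A Ha AF Θ : ℝ≥0∞} (hA : HolderEnvelope (lift a) N r A Ha γ)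
    (hF : ∀ l, HolderEnvelope (lift (ibpField m D l)) N r AF (AF * Θ) γ) :
    ∀ n, n ≤ N → HolderEnvelope (lift ((ibpOpVec m D)^[n] a)) (N - n) r
      (A * (ibpOpConst N * AF * γ) ^ n)
      ((ibpOpConst N * AF * γ) ^ n * (Ha + n * A * Θ)) γ
  | 0, _ => by
      simpa using hA
  | n + 1, hn => by
      have hn' : n ≤ N := Nat.le_of_succ_le hn
      have IH := holderEnvelope_lift_iterate_ibpOpVec hĈ hD hND hm ha hA hF n hn'
      set t : ℝ≥0∞ := ibpOpConst N * AF * γ with ht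
      -- the step at order `k = N - n - 1`
      set k : ℕ := N - (n + 1) with hk
      have hk1 : N - n = k + 1 := by omega
      rw [hk1] at IH
      have hFk : ∀ l, HolderEnvelope (lift (ibpField m D l)) (k + 1) r AF (AF * Θ) γ := fun l =>
        (hF l).mono (by omega) le_rfl le_rfl
      have hstep := holderEnvelope_lift_ibpOpVec hĈ hD hND hm
        (isSmooth_iterate_ibpOpVec hĈ hD hND hm ha n) IH hFk
      rw [← Function.iterate_succ_apply' (ibpOpVec m D) n a] at hstep
      have hKk : ibpOpConst k ≤ ibpOpConst N := ibpOpConst_mono (by omega)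
      refine hstep.mono le_rfl ?_ ?_
      · -- `K_L(k) (A tⁿ) A_F γ ≤ A t^{n+1}`
        calc ibpOpConst k * (A * t ^ n) * AF * γ
            ≤ ibpOpConst N * (A * t ^ n) * AF * γ := by gcongr
          _ = A * (t ^ n * (ibpOpConst N * AF * γ)) := by ring
          _ = A * t ^ (n + 1) := by rw [← ht, pow_succ]
      · -- `K_L(k) (Hₙ A_F + Aₙ A_F Θ) γ ≤ t^{n+1} (H_a + (n+1) A Θ)`
        calc ibpOpConst k * (t ^ n * (Ha + n * A * Θ) * AF + A * t ^ n * (AF * Θ)) * γ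
            ≤ ibpOpConst N * (t ^ n * (Ha + n * A * Θ) * AF + A * t ^ n * (AF * Θ)) * γ := by
              gcongr
          _ = t ^ n * (ibpOpConst N * AF * γ) * (Ha + n * A * Θ + A * Θ) := by ring
          _ = t ^ (n + 1) * (Ha + (n + 1 : ℕ) * A * Θ) := by
              rw [← ht, pow_succ]
              push_cast
              ring

end Iterates

end BDSV

end Literature.Analysis.FluidPDE
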